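import Mathlib

/-!
# Venture AbcShadow — SH-27 CURVE SIDE: Chen's Frey `ℚ`-curves `E^t_β(u,v)`, `E^s_β(u,v)` over `K_β = ℚ(z)` and their
# traces of Frobenius at primes of `K_β` (the "realised trace sets" of the residue-class sieve)

HONEST FRAMING. Machinery file of the work-bound cell `abc-shadow` (typer seat `abc-shadow-typ-4`, row SH-27 = the
generalized Fermat equation `a² + b³⁴ = c⁵`, the prime `p = 17` excluded in [Che10, Thm 1] = I. Chen, "On the equation
`a² + b²ᵖ = c⁵`", Acta Arith. 143 (2010) 345–375). NOTHING in this file is a theorem about a Diophantine equation and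
nothing here is a claim on abc, on any summit, or on IUT. ADJACENT (signature `(2, 2p, 5)`), NOT abc.

What is here (all definitions COMPUTABLE, so that `decide` evaluates them in the kernel — see `SH27/CurveTables.lean`):

* `ℤ[z] = ℤ[X]/(X⁴ − 5X² + 5)` on 4-lists (`zmul`, …): `K_β = ℚ(z)`, `z⁴ − 5z² + 5 = 0`, is the splitting field of the
  cocycle of Chen's `ℚ`-curves [Che10, p.356 L31–37: "`K_β = ℚ(z)`", units `u₂ = 2 − z²`, `u₃ = −z² + z + 2`];
  `√5 = 2z² − 5` (`sqrt5Z`); the twisting elements `γ_t = z³ + z² − 2z` [p.357 L78–80] and `γ_s = z²·γ_t = 3z³ + 5z² − 5z − 5`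
  [p.356 L54–56] (`gammaT`, `gammaS`; `kbeta_sanity`). `ℤ[z]` is the maximal order (disc `= 2000 =` disc `K_β`).
* The PRINTED Frey curves over `ℚ(√5)` attached to a putative solution with Lemma-3 parameters `(s, t) = (v², u²)`
  [Che10, Lemma 3 p.346; (2) and (5) p.351]:
  `E^s : Y² = X³ − 3δ((3 + 2√5)s − 3t)X + 4v((17 − 4√5)s − (45 − 18√5)t)`, `δ = (−5 + 3√5)/2`, and
  `E^t : Y² = X³ − 3·2²·√5(3s − (15 − 10√5)t)X + 2⁵·5u(9s − (45 − 14√5)t)` (the `√5` in the `X`-coefficient of (5) is the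
  reading forced by the printed discriminant/`j` identities (6), (7) — certificate 1f9122f05be32705 gate G-M1, spec
  9d55c9c4a06f0a3d §2.1/A.0), expanded in `u, v` (`printedA4`, `printedA6`), and their `K_β`-MODELS `E_β`
  [Che10, (10) p.357]: `a₄ ↦ a₄·γ²`, `a₆ ↦ a₆·γ³` with `γ = γ_s` for `E^s`, `γ = γ_t` for `E^t` (`modelA4`, `modelA6`).
  Print's choice: `E = E^s` if `5 ∣ s`, `E = E^t` if `5 ∤ s` [p.365 L9–10] (`CurveTag`).
* `γ(u,v) = v⁴ − 10u²v² + 5u⁴ = s² − 10st + 5t²` (`gammaUV`; over `ZMod q`: `gammaZ`): `E` has good reduction at every prime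
  `𝔮 ∤ 30` of `K_β` not dividing `γ(u,v)` [Che10, Cor 8, Thms 38–39; (3), (6)].
* The residue field `𝔽_𝔮 = 𝔽_q[z]/(h)` of a prime `𝔮 = (q, h(z))` of RESIDUE DEGREE 2 (`q ≡ ±9 (mod 20)`, `h = z² + c₁z + c₀`
  an irreducible factor of `z⁴ − 5z² + 5 (mod q)`) as pairs over `ZMod q` (`F2`, `mulh`, `normh`), the trace of Frobenius
  `a_𝔮(E_β(u,v)) = q² + 1 − #E_β(u,v)(𝔽_𝔮) = −Σ_{x ∈ 𝔽_𝔮} χ(x³ + a₄x + a₆)` with `χ` the quadratic character of `𝔽_𝔮`,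
  computed as the Legendre symbol of the norm, `χ(w) = (N_{𝔽_𝔮/𝔽_q}(w) / q)` [folklore: `w^{(q²−1)/2} = N(w)^{(q−1)/2}`]
  (`legendreZ`, `traceF2`, `curveTrace2`); a generic-degree reference implementation on coefficient lists with Euler's
  criterion (`curveTraceGen`) and the dispatcher `curveTrace` (degree 2 ↦ the pair arithmetic); the residue degree
  `f(q) ∈ {1, 2, 4}` of `q ∤ 10` in `K_β = ℚ(ζ₂₀)⁺` [Che10, p.369 L10–14: "`G_{K_β/ℚ} ≅ (ℤ/20ℤ)*/{±1}`", `±3, ±7` generators]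
  (`fdeg`) and the decidable predicate "`h` is a monic degree-`f(q)` factor of `z⁴ − 5z² + 5 (mod q)`" (`IsKbetaPrime`) —
  exactly the primes `𝔮 ∣ q` of `ℤ[z]` for `q ∤ 10` (Dedekind–Kummer; all prime factors have the same degree `f(q)`).
* The TWIST RULE `a_𝔮(E_β(λu, λv)) = a_𝔮(E_β(u, v))` (`λ ∈ 𝔽_q^×`, residue degree 2) and the singular-class bookkeeping
  are PROVED in the sibling file `SH27/CurveTwist.lean`; the kernel tables are `SH27/CurveTables.lean`, `SH27/CurveTable29.lean`.

Faithfulness cross-checks of the typed models against TWO independent external computations (engine certificate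
1f9122f05be32705 block (K), PARI `ellcard`; critic re-derivation crit-1-SH27-K3.md 1a88b4065e90d063, stdlib, by a different
identity) are kernel facts in `SH27/CurveTables.lean` (e.g. the full value sets `{−14, 6, 18, 22}` at `q = 11` and
`{−42, 22, 42, 54, 58}` at `q = 29`, and the CM control values `A_{E^t}(0,1) = A_{E^s}(1,0) = 42` at `q = 29` = spec C-E4).
References: [Che10] as above; cell documents: ENGINE-SPEC-SH27 (sha16 9d55c9c4a06f0a3d) §2–§4, certificate-sh27.txt
(sha16 1f9122f05be32705) blocks (M), (K). AI-typed; weaker than expert refereeing.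
-/

namespace Summit.Ventures.AbcShadow
namespace SH27

/-! ## The order `ℤ[z]`, `z⁴ = 5z² − 5` -/

/-- Product in `ℤ[z] = ℤ[X]/(X⁴ − 5X² + 5)` of two elements given as little-endian 4-lists `[c₀, c₁, c₂, c₃]`
(`= c₀ + c₁z + c₂z² + c₃z³`; missing entries read as `0`), reduced with `z⁴ = 5z² − 5`. [folklore] -/
def zmul (a b : List ℤ) : List ℤ :=
  let c := fun (l : List ℤ) (i : ℕ) => l.getD i 0
  let r : List ℤ := (List.range 7).map fun k =>
    ((List.range 4).map fun i => if i ≤ k ∧ k - i < 4 then c a i * c b (k - i) else 0).sum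
  let r6 := c r 6
  let r5 := c r 5
  let r4 := c r 4 + 5 * r6
  [c r 0 - 5 * r4, c r 1 - 5 * r5, c r 2 + 5 * r4 - 5 * r6, c r 3 + 5 * r5]

/-- Sum in `ℤ[z]` (4-lists). [folklore] -/
def zadd (a b : List ℤ) : List ℤ := (List.range 4).map fun i => a.getD i 0 + b.getD i 0

/-- Integer multiple in `ℤ[z]`. [folklore] -/
def zscal (k : ℤ) (a : List ℤ) : List ℤ := (List.range 4).map fun i => k * a.getD i 0

/-- Power in `ℤ[z]`. [folklore] -/
def zpow (a : List ℤ) : ℕ → List ℤ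
  | 0 => [1, 0, 0, 0]
  | n + 1 => zmul (zpow a n) a

/-- `√5 = 2z² − 5 ∈ ℤ[z]` (`(2z² − 5)² = 4z⁴ − 20z² + 25 = 5`). [cite: Chen2010, p.356 (K_β = ℚ(z), z⁴ − 5z² + 5 = 0)] -/
def sqrt5Z : List ℤ := [-5, 0, 2, 0]

/-- `a + b√5` as an element of `ℤ[z]`. [folklore] -/
def zlin (a b : ℤ) : List ℤ := zadd [a, 0, 0, 0] (zscal b sqrt5Z)

/-- The twisting element `γ_t = z³ + z² − 2z` of the `K_β`-model of `E^t` ("A similar calculation can be made for `E = E^t`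
with exactly the same `β` as above but `γ = z³ + z² − 2z`"). [cite: Chen2010, p.357 L78–80] -/
def gammaT : List ℤ := [0, -2, 1, 1]

/-- The twisting element `γ_s = γ = z²·(z³ + z² − 2z) = 3z³ + 5z² − 5z − 5` of the `K_β`-model (10) of `E^s`.
[cite: Chen2010, p.356 L54–56 and (10) p.357] -/
def gammaS : List ℤ := [-5, -5, 5, 3]

/-- Kernel sanity of the `ℤ[z]` data: `(√5)² = 5` and `z²·γ_t = γ_s` (certificate 1f9122f05be32705 gate G-M3).
[cite: Chen2010, p.356 L54–56] -/
theorem kbeta_sanity : zmul sqrt5Z sqrt5Z = [5, 0, 0, 0] ∧ zmul (zmul [0, 1, 0, 0] [0, 1, 0, 0]) gammaT = gammaS := by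
  decide

/-! ## The Frey `ℚ`-curves and their `K_β`-models -/

/-- Which of Chen's two Frey curves is attached to the solution: `t` ↦ `E^t` (used when `5 ∤ s`), `s` ↦ `E^s` (when `5 ∣ s`).
[cite: Chen2010, p.365 L9–10] -/
inductive CurveTag where
  | t | s
  deriving DecidableEq, Repr

/-- The `X`-coefficient `a₄` of the PRINTED curve over `ℚ(√5)` as a form in `(u, v)` (`s = v²`, `t = u²`): list of monomials
`(i, j, c)` meaning `c·uⁱvʲ`, `c ∈ ℤ[√5] ⊂ ℤ[z]`. `E^t` (5): `−3·2²·√5·(3s − (15 − 10√5)t) = (180√5 − 600)u² − 36√5·v²`;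
`E^s` (2): `−3δ((3 + 2√5)s − 3t)`, `δ = (−5 + 3√5)/2`, `= ((27√5 − 45)/2)u² + ((3√5 − 45)/2)v² = (27z² − 90)u² + (3z² − 30)v²`.
[cite: Chen2010, (2) and (5) p.351] -/
def printedA4 : CurveTag → List (ℕ × ℕ × List ℤ)
  | .t => [(2, 0, zlin (-600) 180), (0, 2, zlin 0 (-36))]
  | .s => [(2, 0, [-90, 0, 27, 0]), (0, 2, [-30, 0, 3, 0])]

/-- The constant coefficient `a₆` of the PRINTED curve as a form in `(u, v)`: `E^t` (5): `2⁵·5u(9s − (45 − 14√5)t) =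
(2240√5 − 7200)u³ + 1440·uv²`; `E^s` (2): `4v((17 − 4√5)s − (45 − 18√5)t) = (72√5 − 180)u²v + (68 − 16√5)v³`.
[cite: Chen2010, (2) and (5) p.351] -/
def printedA6 : CurveTag → List (ℕ × ℕ × List ℤ)
  | .t => [(3, 0, zlin (-7200) 2240), (1, 2, zlin 1440 0)]
  | .s => [(2, 1, zlin (-180) 72), (0, 3, zlin 68 (-16))]

/-- The twisting element of the `K_β`-model: `γ_t` for `E^t`, `γ_s` for `E^s`. [cite: Chen2010, p.357] -/
def gammaOf : CurveTag → List ℤ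
  | .t => gammaT
  | .s => gammaS

/-- `a₄` of the `K_β`-model `E_β(u,v)`: `a₄ · γ²` [Che10 (10)], as a monomial list with coefficients in `ℤ[z]`.
[cite: Chen2010, (10) p.357] -/
def modelA4 (E : CurveTag) : List (ℕ × ℕ × List ℤ) :=
  (printedA4 E).map fun m => (m.1, m.2.1, zmul m.2.2 (zpow (gammaOf E) 2))

/-- `a₆` of the `K_β`-model `E_β(u,v)`: `a₆ · γ³` [Che10 (10)]. [cite: Chen2010, (10) p.357] -/
def modelA6 (E : CurveTag) : List (ℕ × ℕ × List ℤ) :=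
  (printedA6 E).map fun m => (m.1, m.2.1, zmul m.2.2 (zpow (gammaOf E) 3))

/-- `γ(u, v) = v⁴ − 10u²v² + 5u⁴` (`= s² − 10st + 5t²` with `s = v²`, `t = u²`): the second factor of `b^p = v·γ(u,v)` in
Lemma 3; `E` has multiplicative reduction exactly above the primes `q ∉ {2,3,5}` dividing it. [cite: Chen2010, Lemma 3 p.346 and Cor 8 p.347] -/
def gammaUV (u v : ℤ) : ℤ := v ^ 4 - 10 * u ^ 2 * v ^ 2 + 5 * u ^ 4

/-- `γ(u, v)` over `ZMod q`. [cite: Chen2010, Lemma 3 p.346] -/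
def gammaZ {q : ℕ} (u v : ZMod q) : ZMod q := v ^ 4 - 10 * u ^ 2 * v ^ 2 + 5 * u ^ 4

/-! ## Residue fields of degree 2: `𝔽_q[z]/(z² + c₁z + c₀)` as pairs `(a, b) = a + b·z̄` over `ZMod q` -/

/-- Elements `a + b z̄` of `𝔽_q[z]/(z² + c₁ z + c₀)` as pairs over `ZMod q` (addition is componentwise). [folklore] -/
abbrev F2 (q : ℕ) := ZMod q × ZMod q

section F2ops
variable {q : ℕ}

/-- Multiplication in `𝔽_q[z]/(z² + c₁z + c₀)` on pairs, with `n₀ = −c₀`, `n₁ = −c₁` (`z̄² = n₁ z̄ + n₀`). [folklore] -/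
def mulh (n0 n1 : ZMod q) (x y : F2 q) : F2 q :=
  (x.1 * y.1 + n0 * (x.2 * y.2), x.1 * y.2 + x.2 * y.1 + n1 * (x.2 * y.2))

/-- The norm `N(a + b z̄) = (a + b z̄)(a + b z̄') = a² − c₁ab + c₀b²` to `𝔽_q` (arguments `c₀` and `n₁ = −c₁`). [folklore] -/
def normh (c0 n1 : ZMod q) (x : F2 q) : ZMod q := x.1 * x.1 + n1 * (x.1 * x.2) + c0 * (x.2 * x.2)

/-- `x³ + a₄x + a₆` in the residue field. [folklore] -/
def rhsW (n0 n1 : ZMod q) (A4 A6 x : F2 q) : F2 q := mulh n0 n1 x (mulh n0 n1 x x + A4) + A6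

/-- Image of `e = e₀ + e₁z + e₂z² + e₃z³ ∈ ℤ[z]` in `𝔽_q[z]/(z² + c₁z + c₀)`. [folklore] -/
def redZ (n0 n1 : ZMod q) (e : List ℤ) : F2 q :=
  let zb : F2 q := (0, 1)
  let z2 := mulh n0 n1 zb zb
  let z3 := mulh n0 n1 z2 zb
  ((((e.getD 0 0 : ℤ) : ZMod q), ((e.getD 1 0 : ℤ) : ZMod q)) : F2 q) +
    ((e.getD 2 0 : ℤ) : ZMod q) • z2 + ((e.getD 3 0 : ℤ) : ZMod q) • z3

/-- Evaluate a monomial list `Σ c·uⁱvʲ` (coefficients in `ℤ[z]`) at `u, v ∈ 𝔽_q`, in the residue field. [folklore] -/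
def evalModelZ (n0 n1 : ZMod q) (m : List (ℕ × ℕ × List ℤ)) (u v : ZMod q) : F2 q :=
  m.foldr (fun t acc => (u ^ t.1 * v ^ t.2.1) • redZ n0 n1 t.2.2 + acc) 0

end F2ops

/-- Legendre symbol `(n / q)` for an odd prime `q`, by Euler's criterion `n^{(q−1)/2} ∈ {0, 1, −1}` (the power is taken on
the representative in `ℕ` and cast back, which is the same element of `ZMod q`, `legendreZ_eq`). [folklore] -/
def legendreZ (q : ℕ) (n : ZMod q) : ℤ :=
  if n = 0 then 0 else if ((n.val ^ ((q - 1) / 2) : ℕ) : ZMod q) = 1 then 1 else -1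

/-- **Trace of Frobenius over a residue field of degree 2.** For `𝔮 = (q, z² + c₁z + c₀)` and a curve `Y² = X³ + a₄X + a₆`
over `𝔽_𝔮 = 𝔽_q[z]/(z² + c₁z + c₀)`: `a_𝔮 = q² + 1 − #E(𝔽_𝔮) = −Σ_{x ∈ 𝔽_𝔮} χ(x³ + a₄x + a₆)` with `χ` the quadratic
character of `𝔽_𝔮`, evaluated as `χ(w) = (N(w) / q)` (for `w ∈ 𝔽_{q²}^×`: `w^{(q²−1)/2} = (w^{q+1})^{(q−1)/2} = N(w)^{(q−1)/2}`).
Meaningful when `q` is an odd prime and `z² + c₁z + c₀` is irreducible mod `q`. [folklore] -/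
def traceF2 (q : ℕ) [NeZero q] (c0 c1 : ℤ) (A4 A6 : F2 q) : ℤ :=
  -∑ x : F2 q, legendreZ q (normh (c0 : ZMod q) (-(c1 : ZMod q)) (rhsW (-(c0 : ZMod q)) (-(c1 : ZMod q)) A4 A6 x))

/-- **`a_𝔮(E_β(u,v))` at a prime `𝔮 = (q, z² + c₁z + c₀)` of `K_β` of residue degree 2**, for the curve `E ∈ {E^t, E^s}` and
residues `u, v ∈ 𝔽_q` of the Lemma-3 parameters: the integer `q² + 1 − #E_β(u,v)(𝔽_𝔮)` (module docstring). This is the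
quantity `A(u,v)` tabulated in certificate 1f9122f05be32705 block (K). [cite: Chen2010, (2), (5), (10) pp.351–357 (the models reduced mod 𝔮)] -/
def curveTrace2 (E : CurveTag) (q : ℕ) [NeZero q] (c0 c1 : ℤ) (u v : ZMod q) : ℤ :=
  traceF2 q c0 c1 (evalModelZ (-(c0 : ZMod q)) (-(c1 : ZMod q)) (modelA4 E) u v)
    (evalModelZ (-(c0 : ZMod q)) (-(c1 : ZMod q)) (modelA6 E) u v)

/-! ## Generic residue degree (reference implementation on coefficient lists; only degree 2 is used by the kernel sieve) -/

section generic
variable {q : ℕ}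

/-- Coefficientwise difference of little-endian lists over `ZMod q` (longer tail kept / negated). [folklore] -/
def subLq : List (ZMod q) → List (ZMod q) → List (ZMod q)
  | [], r => r.map (fun a => -a)
  | p, [] => p
  | a :: p, b :: r => (a - b) :: subLq p r

/-- Schoolbook product of little-endian lists over `ZMod q`. [folklore] -/
def mulLq : List (ZMod q) → List (ZMod q) → List (ZMod q)
  | [], _ => []
  | a :: p, r => (r.map (a * ·) ++ List.replicate p.length 0).zipWith (· + ·) (0 :: mulLq p r ++ [0])

/-- Reduce a coefficient list modulo the MONIC polynomial `X^f + Σ_{i<f} hl[i] Xⁱ` (given by its lower coefficients `hl`),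
by eliminating top coefficients (`fuel` bounds the number of steps); result has length `≤ f` semantics, padded by the
callers. [folklore] -/
def reduceMonic (hl : List (ZMod q)) : ℕ → List (ZMod q) → List (ZMod q)
  | 0, p => p
  | fuel + 1, p =>
      if p.length ≤ hl.length then p
      else
        let c := p.getLast?.getD 0
        let p' := p.dropLast
        let k := p'.length - hl.length
        reduceMonic hl fuel (subLq p' (List.replicate k 0 ++ hl.map (c * ·)))

/-- Pad/truncate to length `f`. [folklore] -/
def padTo (f : ℕ) (p : List (ZMod q)) : List (ZMod q) := (p ++ List.replicate f 0).take f

/-- Product in `𝔽_q[X]/(h)`, `h` monic with lower coefficients `hl` (elements as lists of length `f = hl.length`). [folklore] -/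
def fqMul (hl : List (ZMod q)) (a b : List (ZMod q)) : List (ZMod q) :=
  padTo hl.length (reduceMonic hl (a.length + b.length) (mulLq a b))

/-- Power in `𝔽_q[X]/(h)` by repeated squaring. [folklore] -/
def fqPow (hl : List (ZMod q)) (a : List (ZMod q)) : ℕ → List (ZMod q)
  | 0 => padTo hl.length [1]
  | n + 1 =>
      let hsq := fqPow hl (fqMul hl a a) ((n + 1) / 2)
      if (n + 1) % 2 = 0 then hsq else fqMul hl hsq a
  decreasing_by all_goals omega

/-- Quadratic character of `𝔽_q[X]/(h)` (a field of `q^f` elements when `h` is irreducible) by Euler's criterion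
`χ(w) = w^{(q^f − 1)/2} ∈ {0, 1, −1}`. [folklore] -/
def eulerChi (q : ℕ) (hl : List (ZMod q)) (w : List (ZMod q)) : ℤ :=
  if w.all (· = 0) then 0
  else if fqPow hl w ((q ^ hl.length - 1) / 2) = padTo hl.length [1] then 1 else -1

/-- All elements of `𝔽_q[X]/(h)` as coefficient lists of length `f`. [folklore] -/
def allElems (q f : ℕ) : List (List (ZMod q)) :=
  (List.range f).foldr (fun _ acc => acc.flatMap fun l => (List.range q).map fun a => (a : ZMod q) :: l) [[]]

/-- Image of `e ∈ ℤ[z]` (4-list) in `𝔽_q[z]/(h)`. [folklore] -/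
def redGen (hl : List (ZMod q)) (e : List ℤ) : List (ZMod q) :=
  padTo hl.length (reduceMonic hl 4 (e.map fun c : ℤ => (c : ZMod q)))

/-- Evaluate a monomial list in `𝔽_q[z]/(h)`. [folklore] -/
def evalModelGen (hl : List (ZMod q)) (m : List (ℕ × ℕ × List ℤ)) (u v : ZMod q) : List (ZMod q) :=
  m.foldr (fun t acc => (padTo hl.length acc).zipWith (· + ·)
    ((redGen hl t.2.2).map ((u ^ t.1 * v ^ t.2.1) * ·))) (padTo hl.length [])

/-- `−Σ_x χ(x³ + a₄x + a₆)` over `𝔽_q[z]/(h)` (lower coefficients `hl`, any degree), `χ` by Euler's criterion. [folklore] -/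
def traceGen (q : ℕ) (hl : List (ZMod q)) (A4 A6 : List (ZMod q)) : ℤ :=
  -(((allElems q hl.length).map fun x =>
      eulerChi q hl ((fqMul hl x ((fqMul hl x x).zipWith (· + ·) A4)).zipWith (· + ·) A6)).sum)

/-- `a_𝔮(E_β(u,v)) = −Σ_x χ(x³ + a₄x + a₆)` over `𝔽_q[z]/(h)` for `h` monic of ANY degree (lower coefficients `hl`), with
`χ` by Euler's criterion — the reference semantics of `curveTrace`. [folklore] -/
def curveTraceGen (E : CurveTag) (q : ℕ) (hl : List (ZMod q)) (u v : ZMod q) : ℤ :=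
  traceGen q hl (evalModelGen hl (modelA4 E) u v) (evalModelGen hl (modelA6 E) u v)

end generic

/-- Lower coefficients (mod `q`) of a monic integer polynomial given as a little-endian list ending in `1`. [folklore] -/
def hLower (q : ℕ) (h : List ℤ) : List (ZMod q) := h.dropLast.map fun c : ℤ => (c : ZMod q)

/-- **`a_𝔮(E_β(u,v))` for a prime `𝔮 = (q, h(z))` of `K_β`** (`h` a monic factor of `z⁴ − 5z² + 5 (mod q)` of degree `f(q)`;
`u, v` the Lemma-3 parameters mod `q`): `q^f + 1 − #E_β(u,v)(𝔽_q[z]/(h))`. Degree-2 `h = z² + c₁z + c₀` is computed by the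
pair arithmetic `curveTrace2` (Legendre symbol of the norm), any other degree by the list arithmetic `curveTraceGen`
(Euler's criterion); both are the same integer by the module docstring's identity. This is the function through which
LEMMA-SH27-1 is stated in `SH27/Che10Package.lean`. [cite: Chen2010, (2), (5), (10) pp.351–357 (the models), p.366 («ρ|G_{K_β} ≅ φ_{E,p}»)] -/
def curveTrace (E : CurveTag) (q : ℕ) [NeZero q] (h : List ℤ) (u v : ZMod q) : ℤ :=
  if h.length = 3 then curveTrace2 E q (h.getD 0 0) (h.getD 1 0) u v else curveTraceGen E q (hLower q h) u v

/-! ## Primes of `K_β` -/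

/-- `z⁴ − 5z² + 5`, the minimal polynomial of `z` (little-endian). [cite: Chen2010, p.356 L31–33] -/
def kbetaPoly : List ℤ := [5, 0, -5, 0, 1]

/-- Residue degree `f(q)` in `K_β = ℚ(ζ₂₀)⁺` of a prime `q ∤ 10`: the order of `q` in `(ℤ/20ℤ)^×/{±1} ≅ Gal(K_β/ℚ)`
(cyclic of order 4, generated by `±3`, `±7`): `1` if `q ≡ ±1`, `2` if `q ≡ ±9`, `4` if `q ≡ ±3, ±7 (mod 20)`.
[cite: Chen2010, p.369 L10–14] -/
def fdeg (q : ℕ) : ℕ :=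
  if q % 20 = 1 ∨ q % 20 = 19 then 1 else if q % 20 = 9 ∨ q % 20 = 11 then 2 else 4

/-- **"`(q, h(z))` is a prime of `K_β` above `q`"** for `q ∤ 10`, as a Boolean check: `h` is a little-endian integer list ending in `1`
(monic) of degree `f(q)` whose reduction divides `z⁴ − 5z² + 5` in `𝔽_q[z]` (remainder zero). Since `q ∤ disc = 2000` is
unramified and `K_β/ℚ` is Galois, every irreducible factor of `z⁴ − 5z² + 5 (mod q)` has degree exactly `f(q)`, so these `h`
are precisely the irreducible factors, i.e. the primes `𝔮 ∣ q` of `ℤ[z] = 𝒪_{K_β}` (Dedekind–Kummer). [folklore] -/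
def kbetaPrimeCheck (q : ℕ) (h : List ℤ) : Bool :=
  decide (h.length = fdeg q + 1) && decide (h.getLast? = some 1) &&
    (reduceMonic (hLower q h) 5 (kbetaPoly.map fun c : ℤ => (c : ZMod q))).all (· = 0)

/-- `IsKbetaPrime q h`: the check `kbetaPrimeCheck q h` passes — "`(q, h(z))` is a prime of `K_β` above `q ∤ 10`" (see
`kbetaPrimeCheck`). [folklore] -/
def IsKbetaPrime (q : ℕ) (h : List ℤ) : Prop := kbetaPrimeCheck q h = true

/-- The primes used by the kernel sieve: `(11, z² + 1)`, `(29, z² + 3)` (residue degree 2) and `(7, z⁴ − 5z² + 5)` (degree 4,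
inert). [folklore] -/
theorem isKbetaPrime_used :
    IsKbetaPrime 11 [1, 0, 1] ∧ IsKbetaPrime 29 [3, 0, 1] ∧ IsKbetaPrime 7 [5, 0, -5, 0, 1] := by
  unfold IsKbetaPrime; decide

end SH27
end Summit.Ventures.AbcShadow
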